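import Literature.Computability.Cryptography.RegevSamplerMachineAbstract
import Literature.Computability.Cryptography.RegevSamplerClassicalDesc
import Literature.Computability.Cryptography.RegevSamplerOracleWord
import Literature.Computability.Cryptography.RegevSamplerGRStageWord
import Literature.Computability.Cryptography.RegevSamplerQFTStageWord
import Literature.Computability.Cryptography.RegevSamplerStageWord
import HarnessLib

/-!
# The machine circuit's abstract gate list as an explicit word, and that word on codes

Topic `Computability/Cryptography` (family `pqc`), grouping namespace `Regev2009.SamplerRegs`; a step of the
uniformity half of [Regev2009, Lemma 3.14 (proof)]: the quantum sampler of the iterative step is ONE uniform circuit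
family, so its gate lists must be printed in polynomial time [AroraBarak2009, §6.2 and proof of Thm. 6.15].

* `classYA Λ`, `classSA Λ`, `classXA Λ` — the abstract gate lists of the three classical blocks of the oracle stage as
  explicit words in the layout's numbers (the right-hand sides of `map_toAG_circY/S/X`);
* `oracleTA Rf Λ` — the abstract tidy block of the solver's word under `subA`;
* `machineAN τ Rf Λ np kk p₀ kF` — **the whole machine word**: GR stage ++ erase layer ++ `Y ++ S ++ T̂ ++ X ++ T̂` ++
  Fourier stage, every segment an explicit function of the sizes;
* `map_toAG_machineCircPar_eq_machineAN` — the data-free machine circuit `machineCircPar` on the standard objects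
  (`stdZone`, `stdEmb`, `srcU`, the table block data `GRTableMach.data τ …`) abstracts to `machineAN`
  (from `map_toAG_machineCircPar_std` and the two block bridges `GRTableMach.map_toAG_blockCircuit_data`,
  `QFTStage.map_toAG_block_eq_blockAN`);
* `machineAN_codeFP_of` — **`machineAN` is computed in polynomial time on codes** from the sizes
  `n, ℓ, ℓY, ℓR, bc, L, Lq, np, kk, p₀, kF` in unary and `base` in binary, over any context (the five stage lemmas
  `grStageAN_codeFP_of`, `eraseA_fp`, `CleanXor.blockWordA_codeFP_of`, `oracleWordA_codeFP_layout`,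
  `qftStageAN_codeFP_of` concatenated by `agAppend`).

Everything is proved; no named fact is introduced.

## References

* O. Regev, *On lattices, learning with errors, random linear codes, and cryptography*, J. ACM 56(6) (2009), Lemma 3.14
  (proof) [Regev2009].
* S. Arora, B. Barak, *Computational Complexity: A Modern Approach*, CUP 2009, §6.2 and proof of Thm. 6.15
  [AroraBarak2009].
* M. A. Nielsen, I. L. Chuang, *Quantum Computation and Quantum Information*, CUP 2010, §3.2.5, §5.1 [NielsenChuang2010].
-/

noncomputable section

namespace Literature.Computability.Cryptography.Regev2009.SamplerRegs

open _root_.Computability Literature.Algebra.EuclideanLattices Literature.Algebra.EuclideanLattices.Regev2009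
  Literature.Computability.QuantumComplexity Literature.Computability.QuantumComplexity.AJLCore
  Literature.Computability.QuantumComplexity.CleanPlaced Literature.Computability.Complexity
  Literature.Computability.Complexity.CodeFP SamplerClassical SamplerClassical.Layout SamplerSubst

/-! ### The explicit words -/

section Words

variable {W n : ℕ} (Λ : Layout W n)

/-- The branch block's abstract gate list as a word in the layout's numbers. [cite: Regev2009, Lemma 3.14 (proof)]
[cite: NielsenChuang2010, §3.2.5] -/
def classYA : List AG :=
  progA ((RevClean.cleanOps eY MY (n * Λ.ℓ + Λ.L) (vY Λ)).map (ClOp.map (relabel (n * Λ.ℓ + Λ.L) (dposD Λ) Λ.base)) ++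
    (CleanXor.xorOpsN eY MY (n * Λ.ℓ + Λ.L) (vY Λ) Λ.base (n * Λ.ℓY) (fun j => Λ.loc (Λ.oY + j)) ++
      ((RevClean.cleanOps eY MY (n * Λ.ℓ + Λ.L) (vY Λ)).map (ClOp.map (relabel (n * Λ.ℓ + Λ.L) (dposD Λ) Λ.base))).reverse))

/-- The residue block's abstract gate list as a word in the layout's numbers. [cite: Regev2009, Lemma 3.14 (proof)]
[cite: NielsenChuang2010, §3.2.5] -/
def classSA : List AG :=
  progA ((RevClean.cleanOps eS MS (n * Λ.ℓ + Λ.L) (vS Λ)).map (ClOp.map (relabel (n * Λ.ℓ + Λ.L) (dposD Λ) Λ.base)) ++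
    (CleanXor.xorOpsN eS MS (n * Λ.ℓ + Λ.L) (vS Λ) Λ.base (n * Λ.ℓR) (fun j => Λ.loc (Λ.oS + j)) ++
      ((RevClean.cleanOps eS MS (n * Λ.ℓ + Λ.L) (vS Λ)).map (ClOp.map (relabel (n * Λ.ℓ + Λ.L) (dposD Λ) Λ.base))).reverse))

/-- The erasing block's abstract gate list as a word in the layout's numbers. [cite: Regev2009, Lemma 3.14 (proof)]
[cite: NielsenChuang2010, §3.2.5] -/
def classXA : List AG :=
  progA ((RevClean.cleanOps eX MX (Λ.regLen + Λ.L) (vX Λ)).map (ClOp.map (relabel (Λ.regLen + Λ.L) (dposX Λ) Λ.base)) ++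
    (CleanXor.xorOpsN eX MX (Λ.regLen + Λ.L) (vX Λ) Λ.base (n * Λ.ℓ) (fun j => Λ.loc j) ++
      ((RevClean.cleanOps eX MX (Λ.regLen + Λ.L) (vX Λ)).map (ClOp.map (relabel (Λ.regLen + Λ.L) (dposX Λ) Λ.base))).reverse))

/-- The abstract tidy block of the solver's word, renamed into the register by `subA`. [cite: Regev2009, Lemma 3.14 (proof)]
[cite: NielsenChuang2010, §3.2.5] -/
def oracleTA (Rf : UniformQCircuitFamily) : List AG :=
  (TidyBlockFn.tidyA Λ.kq (n * Λ.bc) (Rf.family.ancillas Λ.kq) ((Rf.family.circ Λ.kq).gates.map toAG)).map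
    (AGmap (subA Λ.Lq Λ.oU Λ.oS Λ.kq (n * Λ.bc) Λ.oA Λ.base))

/-- **The machine word**: the abstract gate list of the data-free machine circuit as an explicit function of the layout's
numbers, the parameter-word length `np`, the Grover–Rudolph precision `kk = k+1`, the source offset `p₀`, the Fourier
precision `kF`, the level table `τ` and the solver `Rf`. [cite: Regev2009, Lemma 3.14 (proof)]
[cite: AroraBarak2009, §6.2 and proof of Thm. 6.15] -/
def machineAN (τ : LevelCode) (Rf : UniformQCircuitFamily) (np kk p₀ kF : ℕ) : List AG :=
  ((List.range n).flatMap fun i =>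
      (GRStage.blockAN (GRTableMach.cosE τ) (GRTableMach.cosM τ) Λ.ℓ np (GRTableMach.wlen τ Λ.ℓ np) kk
          (GRCosineMach.v np)).map
        (AGmap (embA 0 Λ.ℓ Λ.base (GRData.B Λ.ℓ np (GRTableMach.wlen τ Λ.ℓ np) kk) i))) ++
    (eraseA n np (n * Λ.ℓ + p₀) Λ.base (GRData.B Λ.ℓ np (GRTableMach.wlen τ Λ.ℓ np) kk) Λ.ℓ ++
      (classYA Λ ++ (classSA Λ ++ (oracleTA Λ Rf ++ (classXA Λ ++ (oracleTA Λ Rf ++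
        (List.range n).flatMap fun i =>
          (QFTWord.blockAN Λ.ℓR kF).map (AGmap (embA Λ.oS Λ.ℓR Λ.base (QFTKit.qbsize Λ.ℓR kF) i))))))))

end Words

/-! ### The bridge -/

/-- **The data-free machine circuit on the standard objects abstracts to the machine word.**
[cite: Regev2009, Lemma 3.14 (proof)] [cite: AroraBarak2009, §6.2 and proof of Thm. 6.15] -/
theorem map_toAG_machineCircPar_eq_machineAN {W : ℕ} (I : LatticeInstance) {Λ : Layout W I.n} (hΛ : Λ.OK) (hF : Fits Λ)
    (Rf : UniformQCircuitFamily) (hroomZ : Λ.base + (Λ.kq + Rf.family.ancillas Λ.kq) ≤ W)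
    (τ : LevelCode) (S : ℚ) (p U k np : ℕ) (hnp : (GRCosineMach.pcode ((S, (p, U)), (k, Λ.ℓ))).length ≤ np)
    (hWE : Λ.base + I.n * GRData.B Λ.ℓ np (GRTableMach.wlen τ Λ.ℓ np) (k + 1) ≤ W) {p₀ : ℕ} (hp : p₀ + np ≤ Λ.L)
    (kF : ℕ) (hk : 1 ≤ kF) (hroom : Λ.base + I.n * QFTKit.qbsize Λ.ℓR kF ≤ W) (hloc : ∀ s, Λ.loc s = s) :
    (machineCircPar I hΛ hF Rf (stdZone Λ hΛ hroomZ) (GRTableMach.data τ S p U k Λ.ℓ np hnp) (stdEmb I hΛ hWE)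
        (srcU I Λ p₀) kF hk hroom).gates.map toAG = machineAN Λ τ Rf np (k + 1) p₀ kF := by
  have hfit := blocksFit_stdEmb I hΛ (GRData.ws Λ.ℓ np (GRTableMach.wlen τ Λ.ℓ np) (k + 1))
    (fun j => GRData.ws_val Λ.ℓ np (GRTableMach.wlen τ Λ.ℓ np) (k + 1) j) hWE
  refine (map_toAG_machineCircPar_std I hΛ hF Rf hroomZ (np := np) (wlen := GRTableMach.wlen τ Λ.ℓ np) (kk := k + 1)
    (GRTableMach.data τ S p U k Λ.ℓ np hnp) hWE hp hfit.disj kF hk hroom hloc).trans ?_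
  have hGR : (GRStage.blockCircuit (GRTableMach.data τ S p U k Λ.ℓ np hnp)).gates.map toAG =
      GRStage.blockAN (GRTableMach.cosE τ) (GRTableMach.cosM τ) Λ.ℓ np (GRTableMach.wlen τ Λ.ℓ np) (k + 1) (GRCosineMach.v np) :=
    GRTableMach.map_toAG_blockCircuit_data τ S p U k Λ.ℓ np hnp
  rw [hGR, QFTStage.map_toAG_block_eq_blockAN, map_toAG_circY, map_toAG_circS, map_toAG_circX]
  unfold machineAN
  rw [← finRange_flatMap_coe, ← finRange_flatMap_coe]
  rfl

/-! ### The machine word on codes -/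

section Codes

variable {σ : Type} {eσ : σ → List Bool} {W n : σ → ℕ} (Λ : (c : σ) → Layout (W c) (n c))

/-- The erase layer on codes, context-generic: from `n, np` in unary and `src0, base, B, ℓ` in binary.
[cite: AroraBarak2009, §6.2 and proof of Thm. 6.15] -/
theorem eraseA_codeFP_of {n np src0 base B ℓ : σ → ℕ} (hn : CodeFP eσ unE n) (hnp : CodeFP eσ unE np)
    (hsrc : CodeFP eσ natE src0) (hbase : CodeFP eσ natE base) (hB : CodeFP eσ natE B) (hℓ : CodeFP eσ natE ℓ) :
    CodeFP eσ (rawE agE0) (fun c => eraseA (n c) (np c) (src0 c) (base c) (B c) (ℓ c)) :=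
  (eraseA_fp.comp ((BP.uadd hn hnp).pair ((BP.toNat hn).pair ((BP.toNat hnp).pair (hsrc.pair (hbase.pair (hB.pair hℓ)))))) :
      CodeFP eσ (rawE agE0) (fun c => eraseA (min (n c) (n c + np c)) (min (np c) (n c + np c)) (src0 c) (base c) (B c) (ℓ c))).congr
    fun c => by rw [Nat.min_eq_left (Nat.le_add_right _ _), Nat.min_eq_left (Nat.le_add_left _ _)]

/-- The branch block's word on codes. [cite: Regev2009, Lemma 3.14 (proof)] [cite: AroraBarak2009, §6.2 and proof of Thm. 6.15] -/
theorem classYA_codeFP_of (hloc : ∀ c s, (Λ c).loc s = s) (hn : CodeFP eσ unE n) (hℓ : CodeFP eσ unE (fun c => (Λ c).ℓ))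
    (hℓY : CodeFP eσ unE (fun c => (Λ c).ℓY)) (hL : CodeFP eσ unE (fun c => (Λ c).L)) (hLq : CodeFP eσ unE (fun c => (Λ c).Lq))
    (hbase : CodeFP eσ natE (fun c => (Λ c).base)) : CodeFP eσ (rawE agE0) (fun c => classYA (Λ c)) := by
  have hd : CodeFP eσ unE (fun c => n c * (Λ c).ℓ + (Λ c).L) := BP.uadd (BP.umul hn hℓ) hL
  have hoY : CodeFP eσ natE (fun c => (Λ c).oY) := BP.toNat hd
  exact CleanXor.blockWordA_codeFP_of (e := eY) (M := MY) (BP.toNat hd) (vY_codeFP_of Λ hn hℓ hℓY hLq hd)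
    (NY_codeFP_of Λ hn hℓ hℓY hLq hd) hbase (BP.umul hn hℓY) (dposD_codeFP_of Λ hloc) (locAdd_codeFP_of Λ hloc hoY)

/-- The residue block's word on codes. [cite: Regev2009, Lemma 3.14 (proof)] [cite: AroraBarak2009, §6.2 and proof of Thm. 6.15] -/
theorem classSA_codeFP_of (hloc : ∀ c s, (Λ c).loc s = s) (hn : CodeFP eσ unE n) (hℓ : CodeFP eσ unE (fun c => (Λ c).ℓ))
    (hℓY : CodeFP eσ unE (fun c => (Λ c).ℓY)) (hℓR : CodeFP eσ unE (fun c => (Λ c).ℓR)) (hL : CodeFP eσ unE (fun c => (Λ c).L))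
    (hLq : CodeFP eσ unE (fun c => (Λ c).Lq)) (hbase : CodeFP eσ natE (fun c => (Λ c).base)) :
    CodeFP eσ (rawE agE0) (fun c => classSA (Λ c)) := by
  have hd : CodeFP eσ unE (fun c => n c * (Λ c).ℓ + (Λ c).L) := BP.uadd (BP.umul hn hℓ) hL
  have hoS : CodeFP eσ natE (fun c => (Λ c).oS) := BP.toNat (BP.uadd hd (BP.umul hn hℓY))
  exact CleanXor.blockWordA_codeFP_of (e := eS) (M := MS) (BP.toNat hd) (vS_codeFP_of Λ hn hℓ hℓR hLq hd)
    (NS_codeFP_of Λ hn hℓ hℓR hLq hd) hbase (BP.umul hn hℓR) (dposD_codeFP_of Λ hloc) (locAdd_codeFP_of Λ hloc hoS)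

/-- The erasing block's word on codes. [cite: Regev2009, Lemma 3.14 (proof)] [cite: AroraBarak2009, §6.2 and proof of Thm. 6.15] -/
theorem classXA_codeFP_of (hloc : ∀ c s, (Λ c).loc s = s) (hn : CodeFP eσ unE n) (hℓ : CodeFP eσ unE (fun c => (Λ c).ℓ))
    (hℓY : CodeFP eσ unE (fun c => (Λ c).ℓY)) (hℓR : CodeFP eσ unE (fun c => (Λ c).ℓR)) (hbc : CodeFP eσ unE (fun c => (Λ c).bc))
    (hL : CodeFP eσ unE (fun c => (Λ c).L)) (hLq : CodeFP eσ unE (fun c => (Λ c).Lq))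
    (hbase : CodeFP eσ natE (fun c => (Λ c).base)) : CodeFP eσ (rawE agE0) (fun c => classXA (Λ c)) := by
  have hregU : CodeFP eσ unE (fun c => (Λ c).regLen) := BP.uadd (BP.uadd (BP.umul hn hℓY) (BP.umul hn hℓR)) (BP.umul hn hbc)
  have hdX : CodeFP eσ unE (fun c => (Λ c).regLen + (Λ c).L) := BP.uadd hregU hL
  have hoU : CodeFP eσ natE (fun c => (Λ c).oU) := BP.toNat (BP.umul hn hℓ)
  have hoY : CodeFP eσ natE (fun c => (Λ c).oY) := BP.toNat (BP.uadd (BP.umul hn hℓ) hL)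
  have htpos : CodeFP (pairE eσ natE) natE (fun q => (Λ q.1).loc q.2) := (snd _ _).congr fun q => (hloc q.1 q.2).symm
  exact CleanXor.blockWordA_codeFP_of (e := eX) (M := MX) (BP.toNat hdX) (vX_codeFP_of Λ hn hℓ hℓY hℓR hbc hLq hdX)
    (NX_codeFP_of Λ hn hℓ hℓY hℓR hbc hLq hdX) hbase (BP.umul hn hℓ) (dposX_codeFP_of Λ hloc (BP.toNat hregU) hoY hoU) htpos

/-- The renamed tidy block of the solver's word on codes. [cite: Regev2009, Lemma 3.14 (proof)]
[cite: AroraBarak2009, §6.2 and proof of Thm. 6.15] -/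
theorem oracleTA_codeFP_of (Rf : UniformQCircuitFamily) (hn : CodeFP eσ unE n) (hℓ : CodeFP eσ unE (fun c => (Λ c).ℓ))
    (hℓY : CodeFP eσ unE (fun c => (Λ c).ℓY)) (hℓR : CodeFP eσ unE (fun c => (Λ c).ℓR)) (hbc : CodeFP eσ unE (fun c => (Λ c).bc))
    (hL : CodeFP eσ unE (fun c => (Λ c).L)) (hLq : CodeFP eσ unE (fun c => (Λ c).Lq))
    (hbase : CodeFP eσ natE (fun c => (Λ c).base)) : CodeFP eσ (rawE agE0) (fun c => oracleTA (Λ c) Rf) := by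
  have hoY : CodeFP eσ unE (fun c => (Λ c).oY) := BP.uadd (BP.umul hn hℓ) hL
  have hoS : CodeFP eσ unE (fun c => (Λ c).oS) := BP.uadd hoY (BP.umul hn hℓY)
  exact oracleWordA_codeFP_layout Rf Λ (BP.toNat hLq) (BP.toNat (BP.umul hn hℓ)) (BP.toNat hoS)
    (BP.uadd hLq (BP.umul hn hℓR)) (BP.umul hn hbc) (BP.toNat (BP.uadd hoS (BP.umul hn hℓR))) hbase

/-- **The machine word is computed in polynomial time on codes**, over any context computing the sizes
`n, ℓ, ℓY, ℓR, bc, L, Lq, np, kk, p₀, kF` in unary and `base` in binary (placement `loc = id`).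
[cite: Regev2009, Lemma 3.14 (proof)] [cite: AroraBarak2009, §6.2 and proof of Thm. 6.15] -/
theorem machineAN_codeFP_of (τ : LevelCode) (Rf : UniformQCircuitFamily) (hloc : ∀ c s, (Λ c).loc s = s)
    {np kk p₀ kF : σ → ℕ} (hn : CodeFP eσ unE n) (hℓ : CodeFP eσ unE (fun c => (Λ c).ℓ))
    (hℓY : CodeFP eσ unE (fun c => (Λ c).ℓY)) (hℓR : CodeFP eσ unE (fun c => (Λ c).ℓR)) (hbc : CodeFP eσ unE (fun c => (Λ c).bc))
    (hL : CodeFP eσ unE (fun c => (Λ c).L)) (hLq : CodeFP eσ unE (fun c => (Λ c).Lq))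
    (hbase : CodeFP eσ natE (fun c => (Λ c).base)) (hnp : CodeFP eσ unE np) (hkk : CodeFP eσ unE kk)
    (hp₀ : CodeFP eσ unE p₀) (hkF : CodeFP eσ unE kF) :
    CodeFP eσ (rawE agE0) (fun c => machineAN (Λ c) τ Rf (np c) (kk c) (p₀ c) (kF c)) := by
  have hoS : CodeFP eσ natE (fun c => (Λ c).oS) := BP.toNat (BP.uadd (BP.uadd (BP.umul hn hℓ) hL) (BP.umul hn hℓY))
  have hT := oracleTA_codeFP_of Λ Rf hn hℓ hℓY hℓR hbc hL hLq hbase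
  exact agAppend (grStageAN_codeFP_of τ hn hℓ hnp hkk hbase)
    (agAppend (eraseA_codeFP_of hn hnp (BP.toNat (BP.uadd (BP.umul hn hℓ) hp₀)) hbase
        (BP.toNat (grB_codeFP_of τ hℓ hnp hkk)) (BP.toNat hℓ))
      (agAppend (classYA_codeFP_of Λ hloc hn hℓ hℓY hL hLq hbase)
        (agAppend (classSA_codeFP_of Λ hloc hn hℓ hℓY hℓR hL hLq hbase)
          (agAppend hT (agAppend (classXA_codeFP_of Λ hloc hn hℓ hℓY hℓR hbc hL hLq hbase)
            (agAppend hT (qftStageAN_codeFP_of hn hℓR hkF hoS hbase)))))))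

end Codes

end Literature.Computability.Cryptography.Regev2009.SamplerRegs

end
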